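/-
Origin: expansion seat `planner-pub-hodgecm-pv10-g4-0`, handover #1 2026-08-18T10:24:37Z (`HOME/pub-hodgecm-pv10-g4/lean/Pv10g4/GodementCriterion.lean`, md5 e3f534be, 398 lines);
landed by the gen-7 packager in gate run 28 as `HodgeCM/PerL34/GodementCriterion.lean` (import ^import Pv10g3\.→import HodgeCM.PerL34. ×1; stripped 3 #print/#check/#eval lines).
-/
/-
Origin: pub-hodgecm cell, seat pv10-g4 (unit `pub-hodgecm-pv10-g4`, DAG-node prover #10, gen 4), 2026-08-18.
WIP module `Pv10g4.GodementCriterion`; intended landing place `HodgeCM/PerL34/GodementCriterion.lean`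
(packager import rewrite: `^import Pv10g3\.` ↦ `import HodgeCM.PerL34.`).
-/
import Summits.HodgeConjecture.HodgeCM.PerL34.GodementHyperbolic_2

/-!
# Godement's compactness criterion for unitary groups — both directions

`GodementCompact` (pv10-g3) proved the sufficiency half of Godement's criterion for the unitary group of
a hermitian matrix `H ∈ M_n(L)` over a CM field `L` (`HodgeCM.printFact_unitaryCompact_holds`:
anisotropic ⇒ `U(H)(L⁺)\U(H)(𝔸_{L⁺})` compact), and `GodementHyperbolic` the necessity half in HEIGHT
form (`exists_vecHeight_floor_of_compactSpace`, `not_compactSpace_of_heightCollapse`) together with ONE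
isotropic witness, the hyperbolic plane `(0 1; 1 0)`.

This file closes the criterion: for `H` hermitian and non-degenerate,

  `U(H)(L⁺)\U(H)(𝔸_{L⁺})` is compact  ⇔  `⟪·,·⟫_H` is anisotropic on `Lⁿ`

(`HodgeCM.adelicQuotientCompact_iff_isAnisotropic`; the printed statement is Margulis, *Discrete
subgroups of semisimple Lie groups* (1991), Ch. I, Thm. 3.2.1(b) [held copy, PDF p. 88]: for a connected
reductive `K`-group `G`, "the quotient space `G(K)\G(A_K)` is compact if and only if `G` is anisotropic
over `K`" (char. 0: Borel 1963, loc. cit.), here for `G = U(H)` over `K = L⁺`, which is anisotropic iff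
`⟪·,·⟫_H` is; the height method is Godement's, Sém. Bourbaki 257).

The new content is the necessity half for an ARBITRARY isotropic non-degenerate hermitian `H`, by an
explicit split torus through an isotropic vector, with no Witt decomposition and no change of basis:

* `exists_isHypPair` — an isotropic `ξ ≠ 0` of a non-degenerate hermitian form has a hyperbolic partner
  `η`: `⟪ξ,ξ⟫ = ⟪η,η⟫ = 0`, `⟪ξ,η⟫ = ⟪η,ξ⟫ = 1`;
* `hypMat σ H ξ η t s = 1 + (t - 1) P_{ξ,η} + (s - 1) P_{η,ξ}` with `P_{ξ,η} v = ⟪η,v⟫ ξ`: it maps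
  `ξ ↦ t ξ`, `η ↦ s η`, is multiplicative in `(t, s)` (`hypMat_mul`), and preserves `⟪·,·⟫_H` as soon as
  `σ(t) s = 1 = σ(s) t` (`hermForm_hypMat_mulVec`) — over `𝔸_L` take `s = c(t)⁻¹`;
* `mem_unitaryGroup_iff_hermForm` — `g ∈ U(H)` iff `⟪g u, g v⟫ = ⟪u, v⟫` (Gram matrices are determined
  by their forms, `eq_of_hermForm_eq`);
* `hypAdelicGL_mem`, `hypAdelicGL_mulVec_principalVec` — the adelic torus `a(t) ∈ U(H)(𝔸_{L⁺})` with
  `a(t) ξ_𝔸 = t ξ_𝔸`, so `h(a(t) ξ_𝔸) = ‖t‖_𝔸 h(ξ_𝔸)` collapses (`vecHeight_smul`);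
* `not_compactSpace_of_isotropic` — **necessity**: an isotropic non-degenerate hermitian `H` has a
  non-compact adelic quotient;
* `HodgeCM.adelicQuotientCompact_iff_isAnisotropic` — **the criterion**.

All kernel-proved, no cited facts; closure `[propext, Classical.choice, Quot.sound]` (see the
`#print axioms` lines at the end).  Conventions as in `GodementCompact`: `⟪u, v⟫ = (σ ∘ u) ⬝ᵥ (H *ᵥ v)`
(conjugate-linear in the first variable), column action `g *ᵥ ξ_𝔸`.
-/

set_option autoImplicit false

open scoped NNReal Matrix MatrixGroups
open NumberField IsDedekindDomain Literature.NumberTheory Literature.NumberTheory.Automorphic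
open HodgeCM.Adelic Literature.AlgebraicGeometry.ShimuraVarieties

namespace HodgeCM.PerL34.Godement

/-! ## §1 Sesquilinear algebra over a commutative ring with an endomorphism `σ` -/

section Ring

variable {R : Type*} [CommRing R] {m : Type*} [Fintype m]

/-- (Ported verbatim from the HodgeCMPerL package; no docstring in the source.) -/
theorem hermForm_add_left (σ : R →+* R) (H : Matrix m m R) (u u' v : m → R) :
    hermForm σ H (u + u') v = hermForm σ H u v + hermForm σ H u' v := by
  unfold hermForm
  have h : σ ∘ (u + u') = σ ∘ u + σ ∘ u' := funext fun i => map_add σ (u i) (u' i)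
  rw [h, add_dotProduct]

/-- (Ported verbatim from the HodgeCMPerL package; no docstring in the source.) -/
theorem hermForm_smul_left (σ : R →+* R) (H : Matrix m m R) (c : R) (u v : m → R) :
    hermForm σ H (c • u) v = σ c * hermForm σ H u v := by
  unfold hermForm
  have h : σ ∘ (c • u) = σ c • (σ ∘ u) := funext fun i => map_mul σ c (u i)
  rw [h, smul_dotProduct, smul_eq_mul]

/-- (Ported verbatim from the HodgeCMPerL package; no docstring in the source.) -/
theorem hermForm_add_right (σ : R →+* R) (H : Matrix m m R) (u v v' : m → R) :
    hermForm σ H u (v + v') = hermForm σ H u v + hermForm σ H u v' := by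
  unfold hermForm
  rw [Matrix.mulVec_add, dotProduct_add]

/-- (Ported verbatim from the HodgeCMPerL package; no docstring in the source.) -/
theorem hermForm_smul_right (σ : R →+* R) (H : Matrix m m R) (c : R) (u v : m → R) :
    hermForm σ H u (c • v) = c * hermForm σ H u v := by
  unfold hermForm
  rw [Matrix.mulVec_smul, dotProduct_smul, smul_eq_mul]

/-- **Hermitian symmetry**: for an involution `σ` and `σ(H)ᵀ = H`, `σ ⟪u, v⟫ = ⟪v, u⟫`. -/
theorem conj_hermForm (σ : R →+* R) (hσ : ∀ x, σ (σ x) = x) {H : Matrix m m R}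
    (hH : ∀ i j, σ (H i j) = H j i) (u v : m → R) :
    σ (hermForm σ H u v) = hermForm σ H v u := by
  simp only [hermForm, dotProduct, Matrix.mulVec, Function.comp_apply, map_sum, map_mul, hσ, hH,
    Finset.mul_sum]
  rw [Finset.sum_comm]
  exact Finset.sum_congr rfl fun j _ => Finset.sum_congr rfl fun i _ => by ring

/-- Change of variables: `⟪g u, g v⟫_H = ⟪u, v⟫_{σ(g)ᵀ H g}` for ANY matrix `g`. -/
theorem hermForm_mulVec_mulVec_eq (σ : R →+* R) (H g : Matrix m m R) (u v : m → R) :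
    hermForm σ H (g *ᵥ u) (g *ᵥ v) = hermForm σ ((g.map σ)ᵀ * H * g) u v := by
  unfold hermForm
  have h1 : σ ∘ (g *ᵥ u) = (g.map σ) *ᵥ (σ ∘ u) := funext fun i => RingHom.map_mulVec σ g u i
  rw [h1]
  conv_rhs => rw [Matrix.mul_assoc, ← Matrix.mulVec_mulVec, ← Matrix.mulVec_mulVec,
    Matrix.dotProduct_mulVec, Matrix.vecMul_transpose]

variable [DecidableEq m]

/-- The form on basis vectors recovers the Gram matrix: `⟪e_i, e_j⟫_M = M i j`. -/
theorem hermForm_single_single (σ : R →+* R) (M : Matrix m m R) (i j : m) :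
    hermForm σ M (Pi.single i 1) (Pi.single j 1) = M i j := by
  unfold hermForm
  have h : σ ∘ (Pi.single i (1 : R)) = Pi.single i 1 := by
    funext k
    by_cases hk : k = i
    · subst hk; simp
    · simp [Pi.single_eq_of_ne hk]
  rw [h, Matrix.mulVec_single_one, single_one_dotProduct]
  rfl

/-- A Gram matrix is determined by its form. -/
theorem eq_of_hermForm_eq (σ : R →+* R) {M N : Matrix m m R}
    (h : ∀ u v, hermForm σ M u v = hermForm σ N u v) : M = N := by
  ext i j
  rw [← hermForm_single_single σ M i j, ← hermForm_single_single σ N i j, h]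

/-- **Isometry criterion**: `g ∈ U(H)` iff `⟪g u, g v⟫ = ⟪u, v⟫` for all `u, v`. -/
theorem mem_unitaryGroup_iff_hermForm {σ : R →+* R} {H : Matrix m m R} {g : GL m R} :
    g ∈ unitaryGroup σ H ↔
      ∀ u v, hermForm σ H ((g : Matrix m m R) *ᵥ u) ((g : Matrix m m R) *ᵥ v) = hermForm σ H u v := by
  refine ⟨fun hg u v => hermForm_mulVec_mulVec hg u v, fun h => ?_⟩
  rw [mem_unitaryGroup_iff]
  refine eq_of_hermForm_eq σ fun u v => ?_
  rw [← hermForm_mulVec_mulVec_eq, h]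

/-! ## §2 Hyperbolic pairs and the split torus `a(t, s)` through them -/

/-- A **hyperbolic pair** for `⟪·,·⟫_H`: `⟪ξ,ξ⟫ = ⟪η,η⟫ = 0` and `⟪ξ,η⟫ = ⟪η,ξ⟫ = 1`. -/
structure IsHypPair (σ : R →+* R) (H : Matrix m m R) (ξ η : m → R) : Prop where
  left : hermForm σ H ξ ξ = 0
  right : hermForm σ H η η = 0
  cross : hermForm σ H ξ η = 1
  cross' : hermForm σ H η ξ = 1

/-- The rank-one map `P_{ξ,η} v = ⟪η, v⟫ ξ`, as a matrix. -/
def rankOne (σ : R →+* R) (H : Matrix m m R) (ξ η : m → R) : Matrix m m R :=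
  Matrix.vecMulVec ξ ((σ ∘ η) ᵥ* H)

omit [DecidableEq m] in
/-- (Ported verbatim from the HodgeCMPerL package; no docstring in the source.) -/
theorem rankOne_mulVec (σ : R →+* R) (H : Matrix m m R) (ξ η v : m → R) :
    rankOne σ H ξ η *ᵥ v = hermForm σ H η v • ξ := by
  unfold rankOne hermForm
  rw [Matrix.vecMulVec_mulVec, ← Matrix.dotProduct_mulVec]
  funext i
  simp only [Pi.smul_apply, smul_eq_mul, MulOpposite.smul_eq_mul_unop, MulOpposite.unop_op]
  exact mul_comm _ _

/-- The **hyperbolic family** `a(t, s) = 1 + (t - 1) P_{ξ,η} + (s - 1) P_{η,ξ}`. -/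
def hypMat (σ : R →+* R) (H : Matrix m m R) (ξ η : m → R) (t s : R) : Matrix m m R :=
  1 + (t - 1) • rankOne σ H ξ η + (s - 1) • rankOne σ H η ξ

/-- (Ported verbatim from the HodgeCMPerL package; no docstring in the source.) -/
theorem hypMat_mulVec (σ : R →+* R) (H : Matrix m m R) (ξ η : m → R) (t s : R) (v : m → R) :
    hypMat σ H ξ η t s *ᵥ v =
      v + ((t - 1) * hermForm σ H η v) • ξ + ((s - 1) * hermForm σ H ξ v) • η := by
  unfold hypMat
  rw [Matrix.add_mulVec, Matrix.add_mulVec, Matrix.one_mulVec, Matrix.smul_mulVec,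
    Matrix.smul_mulVec, rankOne_mulVec, rankOne_mulVec, smul_smul, smul_smul]

/-- (Ported verbatim from the HodgeCMPerL package; no docstring in the source.) -/
theorem hypMat_one_one (σ : R →+* R) (H : Matrix m m R) (ξ η : m → R) :
    hypMat σ H ξ η 1 1 = 1 := by
  unfold hypMat
  rw [sub_self, zero_smul, zero_smul, add_zero, add_zero]

variable {σ : R →+* R} {H : Matrix m m R} {ξ η : m → R}

/-- `a(t, s) ξ = t ξ`. -/
theorem IsHypPair.hypMat_mulVec_left (hp : IsHypPair σ H ξ η) (t s : R) :
    hypMat σ H ξ η t s *ᵥ ξ = t • ξ := by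
  rw [hypMat_mulVec, hp.cross', hp.left, mul_one, mul_zero, zero_smul, add_zero, sub_smul, one_smul,
    add_sub_cancel]

/-- `a(t, s) η = s η`. -/
theorem IsHypPair.hypMat_mulVec_right (hp : IsHypPair σ H ξ η) (t s : R) :
    hypMat σ H ξ η t s *ᵥ η = s • η := by
  rw [hypMat_mulVec, hp.right, hp.cross, mul_zero, zero_smul, add_zero, mul_one, sub_smul, one_smul,
    add_sub_cancel]

/-- `a` is multiplicative: `a(t, s) a(t', s') = a(t t', s s')`. -/
theorem IsHypPair.hypMat_mul (hp : IsHypPair σ H ξ η) (t s t' s' : R) :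
    hypMat σ H ξ η t s * hypMat σ H ξ η t' s' = hypMat σ H ξ η (t * t') (s * s') := by
  apply Matrix.mulVec_injective
  funext v
  change (hypMat σ H ξ η t s * hypMat σ H ξ η t' s') *ᵥ v = hypMat σ H ξ η (t * t') (s * s') *ᵥ v
  rw [← Matrix.mulVec_mulVec, hypMat_mulVec σ H ξ η t' s' v, Matrix.mulVec_add, Matrix.mulVec_add,
    Matrix.mulVec_smul, Matrix.mulVec_smul, hp.hypMat_mulVec_left, hp.hypMat_mulVec_right,
    hypMat_mulVec, hypMat_mulVec, smul_smul, smul_smul]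
  module

/-- `a(t, s)` for units `t, s`, as an element of `GL_m(R)` (inverse `a(t⁻¹, s⁻¹)`). -/
def IsHypPair.hypGL (hp : IsHypPair σ H ξ η) (t s : Rˣ) : GL m R where
  val := hypMat σ H ξ η t s
  inv := hypMat σ H ξ η ↑t⁻¹ ↑s⁻¹
  val_inv := by rw [hp.hypMat_mul, Units.mul_inv, Units.mul_inv, hypMat_one_one]
  inv_val := by rw [hp.hypMat_mul, Units.inv_mul, Units.inv_mul, hypMat_one_one]

/-- (Ported verbatim from the HodgeCMPerL package; no docstring in the source.) -/
@[simp] theorem IsHypPair.coe_hypGL (hp : IsHypPair σ H ξ η) (t s : Rˣ) :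
    (hp.hypGL t s : Matrix m m R) = hypMat σ H ξ η t s := rfl

/-- **`a(t, s)` is an isometry** when `σ(t) s = 1 = σ(s) t` (for a hermitian `H` and an involution `σ`):
the only two coefficients that survive in `⟪a u, a v⟫ - ⟪u, v⟫` are `σ(s) t - 1` and `σ(t) s - 1`. -/
theorem IsHypPair.hermForm_hypMat_mulVec (hp : IsHypPair σ H ξ η) (hσ : ∀ x, σ (σ x) = x)
    (hH : ∀ i j, σ (H i j) = H j i) {t s : R} (hts : σ t * s = 1) (hst : σ s * t = 1)
    (u v : m → R) :
    hermForm σ H (hypMat σ H ξ η t s *ᵥ u) (hypMat σ H ξ η t s *ᵥ v) = hermForm σ H u v := by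
  have huξ : hermForm σ H u ξ = σ (hermForm σ H ξ u) := by rw [conj_hermForm σ hσ hH]
  have huη : hermForm σ H u η = σ (hermForm σ H η u) := by rw [conj_hermForm σ hσ hH]
  rw [hypMat_mulVec, hypMat_mulVec]
  simp only [hermForm_add_left, hermForm_add_right, hermForm_smul_left, hermForm_smul_right,
    map_mul, map_sub, map_one, hp.left, hp.right, hp.cross, hp.cross', huξ, huη]
  linear_combination (hermForm σ H η v * σ (hermForm σ H ξ u)) * hst
    + (hermForm σ H ξ v * σ (hermForm σ H η u)) * hts

/-- Hence `a(t, s) ∈ U(H)` when `σ(t) s = 1 = σ(s) t`. -/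
theorem IsHypPair.hypGL_mem (hp : IsHypPair σ H ξ η) (hσ : ∀ x, σ (σ x) = x)
    (hH : ∀ i j, σ (H i j) = H j i) {t s : Rˣ} (hts : σ t * s = 1) (hst : σ s * t = 1) :
    hp.hypGL t s ∈ unitaryGroup σ H :=
  mem_unitaryGroup_iff_hermForm.2 (hp.hermForm_hypMat_mulVec hσ hH hts hst)

end Ring

/-! ## §3 Hyperbolic partners over a field -/

section Field

variable {F : Type*} [Field F] {m : Type*} [Fintype m] [DecidableEq m]

/-- A non-degenerate form pairs every `ξ ≠ 0` non-trivially with some vector. -/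
theorem exists_hermForm_ne_zero (σ : F →+* F) {H : Matrix m m F} (hdet : H.det ≠ 0) {ξ : m → F}
    (hξ : ξ ≠ 0) : ∃ v, hermForm σ H ξ v ≠ 0 := by
  by_contra h
  push Not at h
  have hw : (σ ∘ ξ) ᵥ* H = 0 := by
    funext j
    have hj := h (Pi.single j 1)
    rwa [hermForm, Matrix.dotProduct_mulVec, dotProduct_single_one] at hj
  have hσξ : σ ∘ ξ ≠ 0 := by
    intro h0
    apply hξ
    funext i
    exact (map_eq_zero σ).1 (congrFun h0 i)
  exact hdet (Matrix.exists_vecMul_eq_zero_iff.1 ⟨σ ∘ ξ, hσξ, hw⟩)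

/-- **Hyperbolic partner**: over a field of characteristic zero, an isotropic vector `ξ ≠ 0` of a
non-degenerate hermitian form (`σ` an involution) is half of a hyperbolic pair: from `⟪ξ, η₁⟫ = 1`
put `η = η₁ - (⟪η₁,η₁⟫/2) ξ`. -/
theorem exists_isHypPair [CharZero F] (σ : F →+* F) (hσ : ∀ x, σ (σ x) = x) {H : Matrix m m F}
    (hH : ∀ i j, σ (H i j) = H j i) (hdet : H.det ≠ 0) {ξ : m → F} (hξ : ξ ≠ 0)
    (hξξ : hermForm σ H ξ ξ = 0) : ∃ η, IsHypPair σ H ξ η := by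
  obtain ⟨v, hv⟩ := exists_hermForm_ne_zero σ hdet hξ
  obtain ⟨η₁, h1⟩ : ∃ η₁, hermForm σ H ξ η₁ = 1 :=
    ⟨(hermForm σ H ξ v)⁻¹ • v, by rw [hermForm_smul_right, inv_mul_cancel₀ hv]⟩
  have h1' : hermForm σ H η₁ ξ = 1 := by rw [← conj_hermForm σ hσ hH, h1, map_one]
  have hcc : σ (hermForm σ H η₁ η₁) = hermForm σ H η₁ η₁ := by rw [conj_hermForm σ hσ hH]
  refine ⟨η₁ + (-(hermForm σ H η₁ η₁ / 2)) • ξ, hξξ, ?_, ?_, ?_⟩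
  · simp only [hermForm_add_left, hermForm_add_right, hermForm_smul_left, hermForm_smul_right, h1,
      h1', hξξ, map_neg, map_div₀, hcc, map_ofNat]
    ring
  · rw [hermForm_add_right, hermForm_smul_right, h1, hξξ, mul_zero, add_zero]
  · rw [hermForm_add_left, hermForm_smul_left, h1', hξξ, mul_zero, add_zero]

end Field

/-! ## §4 The adelic split torus through an isotropic vector; necessity of anisotropy -/

section Adelic

variable (L : Type) [Field L] [NumberField L] [IsCMField L]
variable {n : Type} [Fintype n] [DecidableEq n]

local notation "𝔸L" => AdeleRing (𝓞 L) L

omit [Fintype n] [DecidableEq n] in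
/-- The CM conjugation of `L` is an involution (unbundled form of `HodgeCM.conjRingHomK_conjRingHomK`). -/
theorem conjRingHomK_involutive : Function.Involutive (conjRingHomK L) :=
  fun x => IsCMField.complexConj_apply_apply (K := L) x

omit [Fintype n] [DecidableEq n] in
/-- `H_𝔸` is hermitian for `c ⊗ id` when `H` is hermitian for `c`. -/
theorem map_hermitian {H : Matrix n n L} (hH : ∀ i j, conjRingHomK L (H i j) = H j i) (i j : n) :
    adeleConj L (H.map (algebraMap L 𝔸L) i j) = H.map (algebraMap L 𝔸L) j i := by
  rw [Matrix.map_apply, Matrix.map_apply, adeleConj_algebraMap, hH]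

omit [DecidableEq n] in
/-- A hyperbolic pair in `Lⁿ` stays hyperbolic in `𝔸_Lⁿ`. -/
theorem IsHypPair.principalVec {H : Matrix n n L} {ξ η : n → L}
    (hp : IsHypPair (conjRingHomK L) H ξ η) :
    IsHypPair (adeleConj L) (H.map (algebraMap L 𝔸L)) (principalVec L ξ) (principalVec L η) := by
  refine ⟨?_, ?_, ?_, ?_⟩
  · rw [← algebraMap_hermForm, hp.left, map_zero]
  · rw [← algebraMap_hermForm, hp.right, map_zero]
  · rw [← algebraMap_hermForm, hp.cross, map_one]
  · rw [← algebraMap_hermForm, hp.cross', map_one]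

/-- `c(t)⁻¹ = c(t⁻¹)` as an idele. -/
noncomputable def conjInvIdele (t : (𝔸L)ˣ) : (𝔸L)ˣ :=
  Units.map (adeleConj L : 𝔸L →+* 𝔸L).toMonoidHom t⁻¹

/-- (Ported verbatim from the HodgeCMPerL package; no docstring in the source.) -/
@[simp] theorem coe_conjInvIdele (t : (𝔸L)ˣ) :
    (conjInvIdele L t : 𝔸L) = adeleConj L ((t⁻¹ : (𝔸L)ˣ) : 𝔸L) := rfl

/-- **The adelic split torus through the hyperbolic pair `(ξ, η)`**: `a(t) = a(t, c(t)⁻¹)`,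
`t ∈ 𝔸_Lˣ`. -/
noncomputable def hypAdelicGL {H : Matrix n n L} {ξ η : n → L} (hp : IsHypPair (conjRingHomK L) H ξ η)
    (t : (𝔸L)ˣ) : GL n 𝔸L :=
  (hp.principalVec L).hypGL t (conjInvIdele L t)

/-- `a(t) ∈ U(H)(𝔸_{L⁺})`. -/
theorem hypAdelicGL_mem {H : Matrix n n L} (hH : ∀ i j, conjRingHomK L (H i j) = H j i) {ξ η : n → L}
    (hp : IsHypPair (conjRingHomK L) H ξ η) (t : (𝔸L)ˣ) :
    hypAdelicGL L hp t ∈ adelicUnitaryGroup L H := by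
  have hts : adeleConj L (t : 𝔸L) * (conjInvIdele L t : 𝔸L) = 1 := by
    rw [coe_conjInvIdele, ← map_mul, Units.mul_inv, map_one]
  have hst : adeleConj L (conjInvIdele L t : 𝔸L) * (t : 𝔸L) = 1 := by
    rw [coe_conjInvIdele, adeleConj_adeleConj, Units.inv_mul]
  exact (hp.principalVec L).hypGL_mem (adeleConj_adeleConj L) (map_hermitian L hH) hts hst

/-- `a(t) ξ_𝔸 = t ξ_𝔸`. -/
theorem hypAdelicGL_mulVec_principalVec {H : Matrix n n L} {ξ η : n → L}
    (hp : IsHypPair (conjRingHomK L) H ξ η) (t : (𝔸L)ˣ) :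
    (hypAdelicGL L hp t : Matrix n n 𝔸L) *ᵥ principalVec L ξ = (t : 𝔸L) • principalVec L ξ := by
  rw [hypAdelicGL, IsHypPair.coe_hypGL, (hp.principalVec L).hypMat_mulVec_left]

/-- Heights collapse along the torus: `h(a(t) ξ_𝔸) = ‖t‖_𝔸 · h(ξ_𝔸)`. -/
theorem vecHeight_hypAdelicGL_mulVec {H : Matrix n n L} {ξ η : n → L}
    (hp : IsHypPair (conjRingHomK L) H ξ η) (hξ : ξ ≠ 0) (t : (𝔸L)ˣ) :
    vecHeight L ((hypAdelicGL L hp t : Matrix n n 𝔸L) *ᵥ principalVec L ξ) =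
      IdeleClassGroup.ideleNorm L t * vecHeight L (principalVec L ξ) := by
  rw [hypAdelicGL_mulVec_principalVec, vecHeight_smul (isHeightFinite_principalVec hξ)]

/-- **Necessity half of Godement's criterion for unitary groups.**  If `H ∈ M_k(L)` is hermitian and
non-degenerate and `⟪ξ, ξ⟫_H = 0` for some `ξ ∈ Lᵏ ∖ 0`, then `U(H)(L⁺)\U(H)(𝔸_{L⁺})` is NOT compact:
the heights `h(a(t) ξ_𝔸) = ‖t‖_𝔸 h(ξ_𝔸)` along the split torus through `ξ` tend to `0`, against the
height floor forced by compactness (`exists_vecHeight_floor_of_compactSpace`; the "only if" of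
Margulis 1991, Ch. I, Thm. 3.2.1(b), PDF p. 88, for `G = U(H)`; method of Godement, Sém. Bourbaki 257). -/
theorem not_compactSpace_of_isotropic {k : ℕ} (H : Matrix (Fin k) (Fin k) L)
    (hH : ∀ i j, conjRingHomK L (H i j) = H j i) (hdet : H.det ≠ 0) {ξ : Fin k → L} (hξ : ξ ≠ 0)
    (hξξ : hermForm (conjRingHomK L) H ξ ξ = 0) :
    ¬ CompactSpace (adelicUnitaryGroup L H ⧸ adelicUnitaryRat L H) := by
  obtain ⟨η, hp⟩ :=
    exists_isHypPair (conjRingHomK L) (conjRingHomK_involutive L) hH hdet hξ hξξ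
  refine not_compactSpace_of_heightCollapse L H hξ fun ε hε => ?_
  -- the real scalar idele `z(1/2)` has norm `(1/2)^[L:ℚ] < 1`
  have h2 : (2⁻¹ : ℝ≥0) ≠ 0 := inv_ne_zero two_ne_zero
  set t₀ : (𝔸L)ˣ := posRealIdele L (Units.mk0 2⁻¹ h2) with ht₀
  have hnorm : IdeleClassGroup.ideleNorm L t₀ = (2⁻¹ : ℝ≥0) ^ Module.finrank ℚ L :=
    ideleNorm_posRealIdele_holds (K := L) _
  have hlt : IdeleClassGroup.ideleNorm L t₀ < 1 := by
    rw [hnorm]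
    exact pow_lt_one₀ zero_le (by norm_num) Module.finrank_pos.ne'
  have hhpos : 0 < vecHeight L (principalVec L ξ) :=
    lt_of_lt_of_le one_pos (one_le_vecHeight_principalVec hξ)
  obtain ⟨N, hN⟩ := exists_pow_lt_of_lt_one (div_pos hε hhpos) hlt
  refine ⟨hypAdelicGL L hp (t₀ ^ N), hypAdelicGL_mem L hH hp _, ?_⟩
  rw [vecHeight_hypAdelicGL_mulVec L hp hξ, map_pow]
  exact (lt_div_iff₀ hhpos).1 hN

end Adelic

end HodgeCM.PerL34.Godement

/-- **Godement's compactness criterion for unitary groups over CM fields (both directions, KERNEL).**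
For a CM field `L`, `n : ℕ` and `H ∈ M_n(L)` hermitian (`c(H)ᵀ = H`) and non-degenerate, the adelic
quotient `U(H)(L⁺)\U(H)(𝔸_{L⁺})` is compact if and only if `⟪x, x⟫_H = 0 ⇒ x = 0` on `Lⁿ`
(Margulis 1991, Ch. I, Thm. 3.2.1(b) [PDF p. 88]: "`G(K)\G(A_K)` is compact if and only if `G` is
anisotropic over `K`", char. 0 due to Borel 1963, for the reductive group `G = U(H)` over `K = L⁺`, which
is anisotropic iff `⟪·,·⟫_H` is).  Sufficiency is `HodgeCM.printFact_unitaryCompact_holds`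
(`GodementCompact`); necessity is `HodgeCM.PerL34.Godement.not_compactSpace_of_isotropic`. -/
theorem HodgeCM.adelicQuotientCompact_iff_isAnisotropic (L : CMField) (n : ℕ)
    (H : Matrix (Fin n) (Fin n) L)
    (hH : ∀ i j, Literature.AlgebraicGeometry.ShimuraVarieties.conjRingHomK L (H i j) = H j i)
    (hdet : H.det ≠ 0) :
    AdelicQuotientCompact L H ↔ IsAnisotropic L H := by
  refine ⟨fun hc => ?_, fun ha => HodgeCM.printFact_unitaryCompact_holds L n H hH ha⟩
  by_contra hna
  unfold IsAnisotropic at hna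
  push Not at hna
  obtain ⟨ξ, hξξ, hξ⟩ := hna
  exact HodgeCM.PerL34.Godement.not_compactSpace_of_isotropic (L := L) H hH hdet hξ hξξ hc

/-- The `det H ≠ 0` hypothesis of the criterion is only used for necessity; sufficiency holds for every
hermitian anisotropic `H` (and anisotropy forces `det H ≠ 0`,
`HodgeCM.PerL34.Godement.det_ne_zero_of_anisotropic`). -/
theorem HodgeCM.adelicQuotientCompact_iff_isAnisotropic' (L : CMField) (n : ℕ)
    (H : Matrix (Fin n) (Fin n) L)
    (hH : ∀ i j, Literature.AlgebraicGeometry.ShimuraVarieties.conjRingHomK L (H i j) = H j i) :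
    AdelicQuotientCompact L H ∧ H.det ≠ 0 ↔ IsAnisotropic L H :=
  ⟨fun h => (HodgeCM.adelicQuotientCompact_iff_isAnisotropic L n H hH h.2).1 h.1, fun ha =>
    ⟨HodgeCM.printFact_unitaryCompact_holds L n H hH ha,
      HodgeCM.PerL34.Godement.det_ne_zero_of_anisotropic (L := L) H ha⟩⟩

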